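import Summits.Ventures.Crystal3D.Theorems.StickyWulffConstantGenericWallFloorStarFarCheck
import HarnessLib

/-!
# Kernel discharge of `StarPairFar`, task file 1 of 8: evaluation of the branch and bound on the light tasks — chart 0 (all), charts 1 and 2 with first eighth index in {0,1,2,5,6,7}, chart 3 with first eighth index in {0,1,6,7} (1536 tasks, q-level only)

HONEST FRAMING. Venture `Summits/Ventures/Crystal3D` (cell `crystal3d-full`), helper `--supports` the crux
`GenericWallFloor` (stmt-Ventures-19480) of `route-Ventures-StickyWulffConstant`, line `WallLedgerG`.  Rung credit only;
F-C1 not moved.  COMPUTATIONAL GRADE: `native_decide` (trust base = Lean's compiler/interpreter via `Lean.ofReduceBool`)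
evaluates `checkTask` of part 3 (`…StarFarCheck`) — the self-recomputing exact-integer interval branch and bound of
wulff-p2 g10's lineage-B′ certifier of `StarPairFar` — on the tasks listed in `tasks1`; no certificate data are read.
The eight task files partition the `4 × 8³ = 2048` top tasks (charts × eighths); parts 4–5 turn `checkTask = true` into
the real statement, the final file assembles `StarPairFar`.  Expected evaluation cost of this file (seat measurement,
farm interpreter): about 5 s.
-/

namespace Summit.Ventures.Crystal3D.Theorems.StarFar

/-- The tasks of this file: the light tasks — chart 0 (all), charts 1 and 2 with first eighth index in {0,1,2,5,6,7}, chart 3 with first eighth index in {0,1,6,7} (1536 tasks, q-level only). -/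
def tasks1 : List Task :=
  ((List.finRange 8).flatMap fun i => taskBlock 0 i) ++
    (([0, 1, 2, 5, 6, 7] : List (Fin 8)).flatMap fun i => taskBlock 1 i) ++
    (([0, 1, 2, 5, 6, 7] : List (Fin 8)).flatMap fun i => taskBlock 2 i) ++
    (([0, 1, 6, 7] : List (Fin 8)).flatMap fun i => taskBlock 3 i)

/-- **Every task of this file passes the branch and bound** (evaluation by `native_decide`). -/
theorem tasks1_ok : tasks1.all checkTask = true := by
  native_decide

end Summit.Ventures.Crystal3D.Theorems.StarFar
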